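import Literature.AnabelianGeometry.SemiGraphs.ComponentsReadBack
import Literature.AnabelianGeometry.SemiGraphs.OverStarSectionRigidity

/-!
# Pieces of an object over a SECTION MAP, and the labels of a composite finite étale covering
# ([SemiAnbd] Def. 2.2 (i), p. 23)

Mochizuki, *Semi-graphs of anabelioids*, Publ. RIMS **42** (2006) 221–322, §2, Def. 2.2 (i) and the
paragraph before it, author's manuscript p. 23 [cite: MochizukiSemiAnbd2006, Def. 2.2(i) p.23]: the
vertices (resp. edges) of the finite étale covering attached to `G′ ∈ B(𝒢)` over `v` (resp. `e`) "are the
connected components" of `S_v` (resp. `T_e`), the constituent at such a vertex is the component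
anabelioid `(𝒢_v)_P`; Remark 2.4.1 p. 26 uses that finite étale coverings compose.

PROOF-ONLY toolkit (abc-iut cell, layer L3; FACT-LIST row F-1478 `remark_2_4_1_covering`, residual (L)
«print's finite étale coverings compose, LOCAL clause», bricks (L-S)/(L-A) of
`HOME/staging/w5/w5-d041-g3/L-LOCAL-CLAUSE-DECOMPOSITION.md`; seat abc-iut-w5-d041).  abc-iut-L3-t1's
`ComponentsReadBack.lean` names the components of `Z` inside a piece `m : Y.left ↪ Z` read back through
a local equivalence `α : C_{/P} ⥲ D`.  For a COMPOSITE of coverings the piece at a vertex `w ↦ u` of the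
middle graph is NOT `X_u ×_{A_u} P_w` (print's labelling) but `P_w ×_{σ_w, A_u} X_u` for the SECTION MAP
`σ_w : P_w ⟶ A_u` of the local↔global comparison (`OverStar.sectionMap`; abc-iut-w5-d041's
`FiniteEtaleCoveringLocalGlobalSection`, rigidity `OverStar.isoPullback`), which is a monomorphism by
vertex/branch alignment (abc-iut-w4-d079) and whose image is the component `O(w)` of the «tie»
(abc-iut-f-161).  This file supplies, for such a piece `ε : Y ≅ P ×_{σ} Z` over `P` with `σ = τ ≫ O ↪ A′`:

* `mono_isoHomLeft_comp_pullbackSnd` — the piece `Y.left ⥲ P ×_σ Z → Z` is a sub-object (`σ` mono);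
* `isIso_of_fac_arrow_of_mono` — `τ : P ⟶ O` is an isomorphism (`σ` mono, `P`, `O` connected);
* `componentUnder_componentIn_piece` — every label named inside the piece lies over `O`;
* `le_piece_of_componentUnder_eq` / `exists_componentIn_piece_eq` — conversely a component of `Z` lying
  over `O` lies inside the piece, hence is named by a component of `α Y`;
* `sigma_componentIn_piece_bijective` — **the labels of a composite are bijective**: for families
  indexed by `i ↦ p i` (vertices or edges of the middle graph over those of the base) with
  `i ↦ (p i, O i)` bijective (the «tie»), `(i, K) ↦ (p i, componentIn K)` is a bijection onto
  `Σ k, π₀(Z k)`.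

Pure Galois-category bookkeeping: no semi-graphs, no definition of a notion, no `Prop` fact; nothing
here takes a side on [IUTchIII] Cor. 3.12; typed ≠ proved for F-1478.
-/

namespace Literature.AnabelianGeometry.SemiGraphs

open CategoryTheory CategoryTheory.Limits CategoryTheory.PreGaloisCategory
open Literature.AnabelianGeometry.Anabelioids

universe v₁ v₂ u₁ u₂ w₁ w₂

-- Mathlib's `Over.pullback` / `Over.post` simp lemmas only fire under the pre-v4.2x defeq transparency
-- behaviour, exactly as in `Mathlib/CategoryTheory/Comma/Over/Pullback.lean` (also: `π₀Obj` coercions).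
set_option backward.isDefEq.respectTransparency false

/-! ### One piece `Y ≅ P ×_σ Z` over `P` -/

section PieceMono

variable {C : Type u₁} [Category.{v₁} C] [HasPullbacks C] {P A' Z : C} (σ : P ⟶ A') (g : Z ⟶ A')
  (Y : Over P) (ε : Y ≅ OverStar.pullbackObj σ g)

/-- The piece `Y.left ⥲ P ×_{σ} Z ⟶ Z` is a monomorphism when `σ` is.
[cite: MochizukiSemiAnbd2006, Def. 2.2(i) p.23] -/
theorem mono_isoHomLeft_comp_pullbackSnd [Mono σ] : Mono (ε.hom.left ≫ pullback.snd σ g) := by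
  haveI : IsIso ε.hom.left := by
    change IsIso ((Over.forget P).map ε.hom)
    infer_instance
  exact mono_comp _ _

omit [HasPullbacks C] in
/-- If `σ = τ ≫ (O ↪ A′)` with `σ` a monomorphism, `P` connected (non-initial) and `O` a connected
component, then `τ : P ⟶ O` is an isomorphism. [cite: MochizukiSemiAnbd2006, Def. 2.2(i) p.23] -/
theorem isIso_of_fac_arrow_of_mono [Mono σ] [IsConnected P] (O : π₀Obj A') (τ : P ⟶ (O.1 : C))
    (hτ : τ ≫ O.1.arrow = σ) : IsIso τ := by
  haveI : Mono τ := mono_of_mono_fac hτ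
  haveI := O.2
  exact IsConnected.noTrivialComponent _ τ (fun hI => IsConnected.notInitial (X := P) hI)

end PieceMono

section Piece

variable {C : Type u₁} [Category.{v₁} C] [GaloisCategory C] {D : Type u₂} [Category.{v₂} D]
  {P A' Z : C} (σ : P ⟶ A') (g : Z ⟶ A') (α : Over P ⥤ D) [α.IsEquivalence]
  (Y : Over P) (ε : Y ≅ OverStar.pullbackObj σ g)

/-- **Labels named inside the piece lie over `O`.**  For a component `K` of `α Y`, the component of
`Z` it names through the piece `Y.left ⥲ P ×_σ Z ⟶ Z` lies, along `g : Z ⟶ A′`, over the component `O`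
through which `σ` factors. [cite: MochizukiSemiAnbd2006, Def. 2.2(i) p.23] -/
theorem componentUnder_componentIn_piece [Mono σ] (O : π₀Obj A') (τ : P ⟶ (O.1 : C))
    (hτ : τ ≫ O.1.arrow = σ) (K : π₀Obj (α.obj Y)) :
    haveI : Mono (ε.hom.left ≫ pullback.snd σ g) := mono_isoHomLeft_comp_pullbackSnd σ g Y ε
    componentUnder g (componentIn α Y (ε.hom.left ≫ pullback.snd σ g) K) = O := by
  haveI : Mono (ε.hom.left ≫ pullback.snd σ g) := mono_isoHomLeft_comp_pullbackSnd σ g Y ε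
  refine componentUnder_eq g _
    ((Subobject.underlyingIso ((readBackHom α Y K).left ≫ ε.hom.left ≫ pullback.snd σ g)).hom ≫
      (readBackHom α Y K).left ≫ ε.hom.left ≫ pullback.fst σ g ≫ τ) ?_
  simp only [Category.assoc]
  rw [hτ, pullback.condition]
  have h := underlyingIso_inv_componentIn_arrow α Y (ε.hom.left ≫ pullback.snd σ g) K
  rw [Iso.inv_comp_eq] at h
  rw [h]
  simp only [Category.assoc]

/-- **A component of `Z` over `O` lies inside the piece.**  If `σ = τ ≫ (O ↪ A′)` with `τ` an
isomorphism, every component `K₀` of `Z` lying over `O` along `g` lies inside `Y.left ⥲ P ×_σ Z ⟶ Z`.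
[cite: MochizukiSemiAnbd2006, Def. 2.2(i) p.23] -/
theorem le_piece_of_componentUnder_eq [Mono σ] (O : π₀Obj A') (τ : P ⟶ (O.1 : C))
    (hτ : τ ≫ O.1.arrow = σ) [IsIso τ] (K₀ : π₀Obj Z) (hK₀ : componentUnder g K₀ = O) :
    haveI : Mono (ε.hom.left ≫ pullback.snd σ g) := mono_isoHomLeft_comp_pullbackSnd σ g Y ε
    K₀.1 ≤ Subobject.mk (ε.hom.left ≫ pullback.snd σ g) := by
  haveI : Mono (ε.hom.left ≫ pullback.snd σ g) := mono_isoHomLeft_comp_pullbackSnd σ g Y ε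
  subst hK₀
  obtain ⟨k, hk⟩ := exists_factor_componentUnder g K₀
  refine Subobject.le_mk_of_comm
    (pullback.lift (k ≫ inv τ) K₀.1.arrow (by rw [Category.assoc, ← hτ, IsIso.inv_hom_id_assoc, hk]) ≫
      ε.inv.left) ?_
  rw [Category.assoc, ← Category.assoc ε.inv.left, ← Over.comp_left, Iso.inv_hom_id, Over.id_left,
    Category.id_comp, pullback.lift_snd]

/-- … hence is named by some component of `α Y`. [cite: MochizukiSemiAnbd2006, Def. 2.2(i) p.23] -/
theorem exists_componentIn_piece_eq [Mono σ] (O : π₀Obj A') (τ : P ⟶ (O.1 : C))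
    (hτ : τ ≫ O.1.arrow = σ) [IsIso τ] (K₀ : π₀Obj Z) (hK₀ : componentUnder g K₀ = O) :
    haveI : Mono (ε.hom.left ≫ pullback.snd σ g) := mono_isoHomLeft_comp_pullbackSnd σ g Y ε
    ∃ K : π₀Obj (α.obj Y), componentIn α Y (ε.hom.left ≫ pullback.snd σ g) K = K₀ :=
  exists_componentIn_eq α Y _ K₀ (le_piece_of_componentUnder_eq σ g Y ε O τ hτ K₀ hK₀)

end Piece

/-! ### The labels of a composite are bijective -/

section Sigma

variable {κ : Type w₁} {ι : Type w₂} (p : ι → κ) (Cat : κ → Type u₁) [∀ k, Category.{v₁} (Cat k)]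
  [∀ k, GaloisCategory (Cat k)] (Dc : ι → Type u₂) [∀ i, Category.{v₂} (Dc i)]
  (A' Z : ∀ k, Cat k) (g : ∀ k, Z k ⟶ A' k) (P : ∀ i, Cat (p i)) (σ : ∀ i, P i ⟶ A' (p i))
  [∀ i, Mono (σ i)] [∀ i, IsConnected (P i)] (α : ∀ i, Over (P i) ⥤ Dc i) [∀ i, (α i).IsEquivalence]
  (Y : ∀ i, Over (P i)) (ε : ∀ i, Y i ≅ OverStar.pullbackObj (σ i) (g (p i)))
  (O : ∀ i, π₀Obj (A' (p i)))

/-- **The labels of a composite finite étale covering are bijective** ([SemiAnbd] Def. 2.2 (i): the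
vertices of a covering of a covering over `u` are the components of the composite's object over `u`).
For a family of pieces `Y i ≅ P i ×_{σ i} Z (p i)` (indexed by the vertices — or edges — `i` of the
middle graph over `p i` of the base) whose section maps factor `σ i = τ ≫ O i` through components `O i`
with `i ↦ (p i, O i)` BIJECTIVE (the «tie»), the assignment `(i, K) ↦ (p i, componentIn K)` is a
bijection from `Σ i, π₀(α (Y i))` onto `Σ k, π₀(Z k)`. [cite: MochizukiSemiAnbd2006, Def. 2.2(i) p.23] -/
theorem sigma_componentIn_piece_bijective
    (hτ : ∀ i, ∃ τ : P i ⟶ ((O i).1 : Cat (p i)), τ ≫ (O i).1.arrow = σ i)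
    (hO : Function.Bijective (fun i => (⟨p i, O i⟩ : Σ k, π₀Obj (A' k)))) :
    Function.Bijective (fun q : (Σ i, π₀Obj ((α i).obj (Y i))) =>
      (⟨p q.1, by
          haveI : Mono ((ε q.1).hom.left ≫ pullback.snd (σ q.1) (g (p q.1))) :=
            mono_isoHomLeft_comp_pullbackSnd (σ q.1) (g (p q.1)) (Y q.1) (ε q.1)
          exact componentIn (α q.1) (Y q.1) ((ε q.1).hom.left ≫ pullback.snd (σ q.1) (g (p q.1))) q.2⟩ :
        Σ k, π₀Obj (Z k))) := by
  haveI : ∀ i, Mono ((ε i).hom.left ≫ pullback.snd (σ i) (g (p i))) :=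
    fun i => mono_isoHomLeft_comp_pullbackSnd (σ i) (g (p i)) (Y i) (ε i)
  constructor
  · rintro ⟨i₁, K₁⟩ ⟨i₂, K₂⟩ h
    have hlab := congrArg (fun q : (Σ k, π₀Obj (Z k)) =>
      (⟨q.1, componentUnder (g q.1) q.2⟩ : Σ k, π₀Obj (A' k))) h
    obtain ⟨τ₁, hτ₁⟩ := hτ i₁
    obtain ⟨τ₂, hτ₂⟩ := hτ i₂
    simp only [componentUnder_componentIn_piece (σ i₁) (g (p i₁)) (α i₁) (Y i₁) (ε i₁) (O i₁) τ₁ hτ₁,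
      componentUnder_componentIn_piece (σ i₂) (g (p i₂)) (α i₂) (Y i₂) (ε i₂) (O i₂) τ₂ hτ₂] at hlab
    obtain rfl : i₁ = i₂ := hO.1 hlab
    obtain ⟨-, hK⟩ := Sigma.mk.inj_iff.mp h
    obtain rfl : K₁ = K₂ := componentIn_injective _ _ _ (eq_of_heq hK)
    rfl
  · rintro ⟨k, K₀⟩
    obtain ⟨i, hi⟩ := hO.2 ⟨k, componentUnder (g k) K₀⟩
    obtain ⟨rfl, hP⟩ := Sigma.mk.inj_iff.mp hi
    have hP' : componentUnder (g (p i)) K₀ = O i := (eq_of_heq hP).symm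
    obtain ⟨τ, hτi⟩ := hτ i
    haveI := isIso_of_fac_arrow_of_mono (σ i) (O i) τ hτi
    obtain ⟨K, hK⟩ := exists_componentIn_piece_eq (σ i) (g (p i)) (α i) (Y i) (ε i) (O i) τ hτi K₀ hP'
    exact ⟨⟨i, K⟩, Sigma.ext rfl (heq_of_eq hK)⟩

end Sigma

end Literature.AnabelianGeometry.SemiGraphs
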